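import Literature.IUT.HodgeArakelov.RadialGraphsEx19iiiProofs
import Literature.IUT.HodgeArakelov.AbsTopQuotientMaps

/-!
# [IUTchII] §1, Example 1.9 (iii) at the GENUINE quotient functor `Π ↦ Π/Δ` — PROOF companion II

Proof-only companion (abc-iut cell, block C / W6 cone provers, seat abc-iut-w6-d020; node **IUTchII:Ex1.9(iii)**,
kernel id `N_IUTchII_Ex1_9_iii`) to `RadialGraphs.lean` (abc-iut-L6-t1, p406616), `RadialGraphsEx19iiiProofs.lean`
(this seat, p428047) and `AbsTopQuotientMaps.lean` (abc-iut-w5-d089: the CONSTRUCTED functor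
`AbsTopMonoids.quotFunctor A : IsoClass Π^tp_{X̲̲_k} ⥤ IsoClass G_k`, `Π ↦ Π/Δ(Π)`, `h ↦` the induced isomorphism
of topological groups `Π/Δ ≅ Π*/Δ*`, over the [AbsTopIII] interface `A : AbsTopMonoids S` whose field `Delta`
is the group-theoretic subgroup `Δ ⊆ Π` of Example 1.8 (i)). No definitions, no new `Prop` facts.

S. Mochizuki, *Inter-universal Teichmüller theory II*, kurims manuscript (Dec. 2020), Example 1.9 (iii), p. 42
l. 54 – p. 43 l. 2 (verbatim): "The radial functor `Φ : ℛ → 𝒞` is defined via the assignment `Π ↦ Π/Δ` [cf. the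
notation of Example 1.8, (i)]. Thus, `Φ` fails to be full [cf., e.g., [AbsTopIII], §I3; [AbsTopIII], Remark
1.9.1]. That is to say, `(ℛ, 𝒞, Φ)` is a uniradial environment." Claim key `Mochizuki2012`, status DISPUTED
(D-0012); record-only.

The landed `ex19iii S Q` takes the radial functor as an abstract input `Q` (typer's docstring: "`Q`, an
interface input … TODO-merge:abc-iut-L4-t1"). Since then the tree has the genuine candidate `Q := A.quotFunctor`.
WHAT IS PROVED HERE, at `Q := A.quotFunctor`:
* `IsoClass.essSurj_of_nonempty` — any functor into the connected groupoid `IsoClass G` out of a nonempty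
  category is essentially surjective; hence `AbsTopMonoids.quotFunctor_essSurj` — Example 1.7 (i)'s standing
  assumption "we shall assume that this functor is essentially surjective" HOLDS for `Π ↦ Π/Δ` (it was an
  instance binder of `ex19iii`); so `ex19iii S A.quotFunctor` is a radial environment with no residual
  hypothesis;
* `AbsTopMonoids.quotFunctor_map_eq_iff` — `Φ(f) = σ` iff `σ` is the map INDUCED by `f` on cosets
  (`σ [x] = [f x]`), from `quotMap_mk`;
* `AbsTopMonoids.quotientFunctor_not_full_quot_iff` — the named input F-0421 `quotientFunctor_not_full` AT
  THE GENUINE QUOTIENT FUNCTOR, in the literal group-theoretic form the cited [AbsTopIII] passages speak of: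
  "`Φ` fails to be full" ⟺ at one (any) isomorph `Π` of `Π^tp_{X̲̲_k}` there is an automorphism `σ` of the
  topological group `Π/Δ` (`≅ G_k`) which is induced by NO automorphism `f` of the topological group `Π`
  (i.e. `σ ∘ (Π ↠ Π/Δ) ≠ (Π ↠ Π/Δ) ∘ f` for every `f`) — [AbsTopIII] Rmk 1.9.4 (kurims pp. 38–39): the
  inertia dimension of `G_k` "is “far from rigid” … the existence [cf., e.g., [NSW], the Closing Remark
  preceding Theorem 12.2.7] of isomorphisms of absolute Galois groups of MLF’s which fail … to be
  “geometric”", while "being “coupled with `Δ_X`” [i.e., via the extension determined by `Π_X`] has the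
  effect of rigidifying both of the 2 dimensions of `G_k` [cf. also Corollary 1.10]" (tempered version: Rmk
  1.9.1, p. 38). Those L4 inputs ([NSW]; [AbsTopIII] Thm 1.9 / Cor 1.10) are NOT restated: they are exactly
  what a witness `σ` with `hσ` would be made of;
* `AbsTopMonoids.quotientFunctor_not_full_quot_iff_base` — the same at the reference object `Π^tp_{X̲̲_k}`
  itself (where `A.Delta (IsoClass.base _) = Δ_X = Ker(Π^tp_{X̲̲_k} ↠ G_k)` by the interface law `Delta_base`);
* `ex19iii_quot_isUniradial_iff` / `ex19iii_quot_uniradiallyDefined_of_aut` — node IUTchII:Ex1.9(iii) at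
  `Q := A.quotFunctor`: "`(ℛ, 𝒞, Φ)` is a uniradial environment" ⟺ such a non-liftable `σ` exists; and from
  one such `σ`, "`Ψ_ℛ` is uniradially defined" for every functorial algorithm `Ξ`.

HONEST FRAMING: category theory and elementary group theory over the typed interfaces (`AbsTopMonoids` is
an interface whose genuine [AbsTopIII] instance is layer-L4 business; `AbsTopMonoidsNonVacuity` shows it is
inhabited iff `Δ` is characteristic and `Π^tp/Δ ≅ G_k`); nothing here bears on [IUTchIII] Cor 3.12 or asserts
anything about abc; the non-liftable automorphism is NOT constructed here (it is the content of F-0421).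
typed ≠ endorsed; no side taken.
-/

namespace Literature.IUT.HodgeArakelov

open CategoryTheory

universe v u u'

/-! ## Functors into the connected groupoid `IsoClass G` are essentially surjective -/

/-- [folklore] Any functor into `IsoClass G` (a connected groupoid: `IsoClass.nonempty_hom`) out of a
nonempty category is essentially surjective — Example 1.7 (i)'s standing assumption "we shall assume that
this functor is essentially surjective" is automatic for coric data "a topological group isomorphic to
`G_k`". [claim: Mochizuki2012, status: disputed] (IUTchII §1 Ex 1.7 (i), kurims p.32) -/
theorem IsoClass.essSurj_of_nonempty {G : TopGroup.{u}} {E : Type u'} [Category.{v} E] [Nonempty E]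
    (Q : E ⥤ IsoClass G) : Q.EssSurj where
  mem_essImage Y := by
    obtain ⟨X⟩ := ‹Nonempty E›
    obtain ⟨e⟩ := IsoClass.nonempty_hom (Q.obj X) Y
    exact ⟨X, ⟨Groupoid.isoEquivHom _ _ |>.symm e⟩⟩

namespace AbsTopMonoids

variable {S : ThetaSetting.{u}} (A : AbsTopMonoids S)

/-- **IUTchII:Ex1.9(iii)** with **Ex1.7(i)**: the genuine quotient functor `Π ↦ Π/Δ` IS essentially
surjective (PROVED; no hypothesis) — so `ex19iii S A.quotFunctor` is a radial environment outright.
[claim: Mochizuki2012, status: disputed] (IUTchII §1 Ex 1.9 (iii), kurims p.42) -/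
theorem quotFunctor_essSurj : A.quotFunctor.EssSurj :=
  haveI : Nonempty (IsoClass S.PiX) := ⟨IsoClass.base S.PiX⟩
  IsoClass.essSurj_of_nonempty A.quotFunctor

/-- `Φ(f) = σ` for the genuine quotient functor iff `σ` is the map induced by `f` on cosets: `σ [x] = [f x]`
for all `x ∈ Π` (from `quotMap_mk`). [claim: Mochizuki2012, status: disputed] (IUTchII §1 Ex 1.8 (i), kurims pp.35-36) -/
theorem quotFunctor_map_eq_iff {P Q : IsoClass S.PiX} (f : P ⟶ Q)
    (σ : A.quotFunctor.obj P ⟶ A.quotFunctor.obj Q) :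
    A.quotFunctor.map f = σ ↔
      ∀ x : P.G, IsoClass.homIso σ (QuotientGroup.mk x : P.G ⧸ A.Delta P) =
        (QuotientGroup.mk (IsoClass.homIso f x) : Q.G ⧸ A.Delta Q) := by
  constructor
  · rintro rfl x
    exact A.quotMap_mk f x
  · intro h
    apply ContinuousMulEquiv.ext
    intro y
    induction y using QuotientGroup.induction_on with
    | H x => exact (A.quotMap_mk f x).trans (h x).symm

/-- **IUTchII:Ex1.9(iii)**, the named input "`Φ` fails to be full [cf., e.g., [AbsTopIII], §I3; [AbsTopIII],
Remark 1.9.1]" (kurims p. 42 l. 57 – p. 43 l. 1) AT THE GENUINE QUOTIENT FUNCTOR `Π ↦ Π/Δ`, in group-theoretic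
form at any one isomorph `Π` of `Π^tp_{X̲̲_k}`: it holds iff some automorphism `σ` of the topological group
`Π/Δ` (`≅ G_k`) is induced by NO automorphism `f` of the topological group `Π`, i.e. for every `f` there is
`x ∈ Π` with `σ [x] ≠ [f x]` — the [AbsTopIII] Rmk 1.9.4 phenomenon (inertia dimension of `G_k` "far from
rigid", [NSW] Closing Remark before Thm 12.2.7) against the rigidification by `Δ_X` (Thm 1.9 / Cor 1.10; Rmk
1.9.1 tempered). PROVED (category theory + the coset formula); the witness itself is F-0421's content, not
constructed here. [claim: Mochizuki2012, status: disputed] (IUTchII §1 Ex 1.9 (iii), kurims pp.42-43) -/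
theorem quotientFunctor_not_full_quot_iff (P : IsoClass S.PiX) :
    Literature.IUT.HodgeArakelov.quotientFunctor_not_full S A.quotFunctor ↔
      ∃ σ : A.quotFunctor.obj P ⟶ A.quotFunctor.obj P, ∀ f : P ⟶ P,
        ∃ x : P.G, IsoClass.homIso σ (QuotientGroup.mk x : P.G ⧸ A.Delta P) ≠
          (QuotientGroup.mk (IsoClass.homIso f x) : P.G ⧸ A.Delta P) := by
  rw [quotientFunctor_not_full_iff_not_surjective S A.quotFunctor P]
  constructor
  · intro h
    by_contra hne
    refine h fun σ => ?_
    by_contra hσ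
    refine hne ⟨σ, fun f => ?_⟩
    by_contra hx
    refine hσ ⟨f, (A.quotFunctor_map_eq_iff f σ).2 fun x => ?_⟩
    by_contra hx'
    exact hx ⟨x, hx'⟩
  · rintro ⟨σ, hσ⟩ hsurj
    obtain ⟨f, hf⟩ := hsurj σ
    obtain ⟨x, hx⟩ := hσ f
    exact hx (((A.quotFunctor_map_eq_iff f σ).1 hf) x)

/-- **IUTchII:Ex1.9(iii)**, the named input at the genuine quotient functor, read at the REFERENCE object
`Π^tp_{X̲̲_k}` itself (`IsoClass.base`; there `A.Delta _ = Δ_X = Ker(Π^tp_{X̲̲_k} ↠ G_k)` by the interface law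
`AbsTopMonoids.Delta_base`): "`Φ` fails to be full" iff some automorphism of the topological group
`Π^tp_{X̲̲_k}/Δ` is induced by no automorphism of the topological group `Π^tp_{X̲̲_k}`.
[claim: Mochizuki2012, status: disputed] (IUTchII §1 Ex 1.9 (iii), kurims pp.42-43) -/
theorem quotientFunctor_not_full_quot_iff_base :
    Literature.IUT.HodgeArakelov.quotientFunctor_not_full S A.quotFunctor ↔
      ∃ σ : A.quotFunctor.obj (IsoClass.base S.PiX) ⟶ A.quotFunctor.obj (IsoClass.base S.PiX),
        ∀ f : S.PiX ≃ₜ* S.PiX, ∃ x : S.PiX,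
          IsoClass.homIso σ (QuotientGroup.mk x : S.PiX ⧸ A.Delta (IsoClass.base S.PiX)) ≠
            (QuotientGroup.mk (f x) : S.PiX ⧸ A.Delta (IsoClass.base S.PiX)) :=
  A.quotientFunctor_not_full_quot_iff (IsoClass.base S.PiX)

/-- **IUTchII:Ex1.9(iii)**, the named input FROM a group-theoretic witness at the genuine quotient functor:
one automorphism `σ` of `Π/Δ` induced by no automorphism of `Π` gives "`Φ` fails to be full".
[claim: Mochizuki2012, status: disputed] (IUTchII §1 Ex 1.9 (iii), kurims pp.42-43) -/
theorem quotientFunctor_not_full_quot_of_aut (P : IsoClass S.PiX)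
    (σ : A.quotFunctor.obj P ⟶ A.quotFunctor.obj P)
    (hσ : ∀ f : P ⟶ P, ∃ x : P.G, IsoClass.homIso σ (QuotientGroup.mk x : P.G ⧸ A.Delta P) ≠
      (QuotientGroup.mk (IsoClass.homIso f x) : P.G ⧸ A.Delta P)) :
    Literature.IUT.HodgeArakelov.quotientFunctor_not_full S A.quotFunctor :=
  (A.quotientFunctor_not_full_quot_iff P).2 ⟨σ, hσ⟩

end AbsTopMonoids

/-! ## Node IUTchII:Ex1.9(iii) at `Q := Π ↦ Π/Δ` -/

section Ex19iiiQuot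

variable {S : ThetaSetting.{u}} (A : AbsTopMonoids S)

/-- **IUTchII:Ex1.9(iii)** (kurims p. 43 l. 1–2) at the genuine quotient functor `Π ↦ Π/Δ` (essential
surjectivity DISCHARGED by `quotFunctor_essSurj`): "`(ℛ, 𝒞, Φ)` is a uniradial environment" IF AND ONLY IF
some automorphism of the topological group `Π/Δ` is induced by no automorphism of `Π` (at any one `Π`).
[claim: Mochizuki2012, status: disputed] (IUTchII §1 Ex 1.9 (iii), kurims p.43) -/
theorem ex19iii_quot_isUniradial_iff (P : IsoClass S.PiX) :
    (@Literature.IUT.HodgeArakelov.ex19iii S A.quotFunctor A.quotFunctor_essSurj).IsUniradial ↔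
      ∃ σ : A.quotFunctor.obj P ⟶ A.quotFunctor.obj P, ∀ f : P ⟶ P,
        ∃ x : P.G, IsoClass.homIso σ (QuotientGroup.mk x : P.G ⧸ A.Delta P) ≠
          (QuotientGroup.mk (IsoClass.homIso f x) : P.G ⧸ A.Delta P) :=
  (@ex19iii_isUniradial_iff S A.quotFunctor A.quotFunctor_essSurj).trans
    (A.quotientFunctor_not_full_quot_iff P)

/-- **IUTchII:Ex1.9(iii)** (kurims p. 43 l. 6–13) at the genuine quotient functor `Π ↦ Π/Δ`: given ONE
automorphism `σ` of some `Π/Δ` induced by no automorphism of `Π` (the [AbsTopIII] §I3 / Rmk 1.9.4 witness),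
"any “functorial group-theoretic algorithm” whose input data consists of a topological group isomorphic to
`Π^tp_{X̲̲_k}` also gives rise — in a tautological fashion — to a uniradially defined functor."
[claim: Mochizuki2012, status: disputed] (IUTchII §1 Ex 1.9 (iii), kurims p.43) -/
theorem ex19iii_quot_uniradiallyDefined_of_aut (P : IsoClass S.PiX)
    (σ : A.quotFunctor.obj P ⟶ A.quotFunctor.obj P)
    (hσ : ∀ f : P ⟶ P, ∃ x : P.G, IsoClass.homIso σ (QuotientGroup.mk x : P.G ⧸ A.Delta P) ≠
      (QuotientGroup.mk (IsoClass.homIso f x) : P.G ⧸ A.Delta P))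
    {F : Type u'} [Category.{v} F] (Ξ : IsoClass S.PiX ⥤ F) :
    ((@Literature.IUT.HodgeArakelov.ex19iii S A.quotFunctor A.quotFunctor_essSurj).toDagger
      Ξ).IsUniradiallyDefined :=
  @Literature.IUT.HodgeArakelov.ex19iii_uniradiallyDefined S A.quotFunctor A.quotFunctor_essSurj
    (A.quotientFunctor_not_full_quot_of_aut P σ hσ) F _ Ξ

end Ex19iiiQuot

end Literature.IUT.HodgeArakelov
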